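import Summits.QuantumFields.YangMills.Theorems.BalabanUVNodesN15CovariantAveragingSandwichKnit
import Summits.QuantumFields.YangMills.Theorems.BalabanUVNodesN15TwoSpacingGluingCurvedKnitCovariantAveragingNode
import Summits.QuantumFields.YangMills.Theorems.BalabanUVNodesN15TwoSpacingGluingCurvedKnitCovariantAveragingNodeFour
import Summits.QuantumFields.YangMills.Theorems.BalabanUVNodesN15TraceFormCoordinates
import HarnessLib

/-!
# N15 (NE2), PROGRAMME Q, part (Q-7): ALL THREE LAYERS WITH dag-n15-c's COVARIANT AVERAGING — THE OPERATOR LAYER OF 189b IN THE SOCKET OF (Q-6c)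

dag-n15-a g31, KNIT-BY-NAME seat, node N15 = NE2. HONEST LABEL: by-name bookkeeping on MODEL carriers (dag-n15-c's two-spacing glued torus,
`sfInstance`; their covariant block averaging `qvCov` ([5] (124)–(125) shape: `Q(U)` = the main term, Landau summand flat) in the operator
layer's entry 0 (189b `ne2PlusOperator_sfq`) AND in the site ∕ unit sandwich ((Q-6a)–(Q-6c))). NOT [B9] Thms 3.1 ∕ 3.2 ∕ 3.14 ∕ 3.15 AS PRINTED.
N15 stays DISCHARGED OF RECORD 8∕28 AS CONSUMED on p687738; nothing here re-claims it; no count.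

PRECISION (v1.3, doc-only, dag-n15-a g32 — LOCATED-X, cell bus 2026-08-29 16:55Z).  In THIS file's literals (`sfObjects₅qv` and §1's) the OPERATOR layer reads dag-n15-c's
glued propagator `X_q` WITH the covariant averaging summand live (189a `sfqEntry0`), while the SITE ∕ UNIT layers ((Q-3) `foSiteCov`, (Q-4) `foCovCovLam`, through (Q-2a) `zCovC`)
sandwich — between the covariant averaging maps `Q⊗1 + D(A′)`, `Q*⊗1 + E(A′)` — dag-n15-c's FILE 133 propagator, whose Bałaban summand is FLAT inside: the covariant averaging is live
AROUND the sandwich's propagator, not INSIDE it, and the literal carries TWO model propagators.  The one-propagator literal (site ∕ unit sandwiches reading `X_q` itself) is PROGRAMME 𝟙P's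
`sfObjects₆qv` (`…N15OnePropagatorAllLayersKnit`, via the generic socket `…N15SmallFieldSiteLayerAnyPropagator` ∕ `…N15SmallFieldUnitLayerAnyPropagator`).  No statement below is changed.

WHAT.  (Q-6c) §4 `live_and_n15At_op_qv_allLiveLam` is GENERIC in the operator layer: any `Kop` with `NE2PlusOperator c₃₅ (sfInstance …) Kop`.
dag-n15-c's 189b `Gluing.ne2PlusOperator_sfq E hE` supplies such a layer — `fun i => sfqFamily d mm ι a e hL i (E i)`, ENTRY 0 = the η-defect of
the glued propagators whose Bałaban summand `N_L ⊗ 1 − N_V^Q` carries the covariant averaging LIVE (their 188, no displayed row), entries 1–3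
a parameter `E` with the displayed (3.42)-shaped row `hE` (their 190–193 close it).  §1 plugs it in:

  ★★★ `live_and_n15At_sfq_qv_allLiveLam E hE : ∃ w, Live ⟨…⟩ ∧ N15At {…}` — operator layer 189b, site layer (Q-3) and unit layer (Q-4) at the
  constructed covariant family, genuine Dirichlet region `inLamSf`, index `SfIdxGE d L w × RegIdx0 d`;

§2 is the honest dictionary at ZERO background field: `qTc_zero`∕`qTf_zero` (transporters = 1), `qDc_zero`∕`qEc_zero`∕`qDf_zero`∕`qEf_zero` (the
constructed family VANISHES at `A′ = 0`: the covariant averaging is the flat one there, (3.80)'s `F₂(0) = 0`), and ★ `foSiteCov_qv_ker_zero` ∕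
`foCovCovLam_qv_ker_zero`: at `A′ = 0` the covariantly averaged site ∕ unit kernels ARE (J-c)'s `foSiteSf` ∕ (Ð-4)'s `foCovSfLam`.
§3 (v1.1, after n15-c's 193b `ne2PlusOperator_sfq₄` landed — all four entries constructed, `E` pinned by three `rfl`-equations): Σ-Q = `sfqE₄ ν₁ ν₂` (the
concrete entry assignment), ★★★ `ne2PlusOperator_sfq₄E` (operator layer, NO parameter, NO displayed row), the CLOSED all-covariant literal `sfObjects₅qv`,
`exists_live_and_n15At_sfObjects₅qv`, the pinned threshold `wQ5`, ★★★ `live_and_n15At_sfObjects₅qv_wQ5`, the keyed face `s_N15_of_admits_sf₅qv`.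
After §3 NOTHING in the road-(c) literal is a parameter or a displayed row: operator layer (entry 0 with the covariant summand live, entries 1–3 the covariant
gradients ∕ Laplacian of 190–193), site and unit layers with the covariant averaging in the sandwich, genuine Dirichlet region — all MODEL level.
§4 (v1.2): the same literal at the trace-form coordinates `e := tfCoords mm` of (T-1) `…N15TraceFormCoordinates` — `he` DISCHARGED, hypotheses purely numeric
(`live_and_n15At_sfObjects₅qv_tf`, `exists_closed_allCovariant_literal`).

References: [5] T. Balaban, CMP 98 (1985) 17–51, (124)–(126) p.36; [B9] T. Balaban, CMP 99 (1985) 389–434, Thm 3.1 (3.42) p.397, Thm 3.2 p.398,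
(3.80)–(3.81) p.406; [King1986] C. King, The U(1) Higgs model. I. The continuum limit, CMP 102 (1986) 649–677, Prop. 3.9 (3.73) p.665
(v1.1: King citation volume corrected — ref-B READ-1011 NIT).
-/

noncomputable section

open scoped BigOperators Matrix

namespace Summit.QuantumFields.YangMills.BalabanUVNodes.N15.SiteLayerSf

open Literature.MathematicalPhysics.QuantumFieldTheory.Balaban1983to89
open Literature.MathematicalPhysics.QuantumFieldTheory.Balaban1983to89.T4EtaRate (NE2PlusOperator rateFactor)
open Literature.MathematicalPhysics.QuantumFieldTheory.Balaban1983to89.B11SectG (BlockNorm HasMaj)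
open Literature.Barriers.QuantumFields (traceForm)
open Summit.QuantumFields.YangMills.BalabanUVNodes.N15.VectorPiece (kingPrV)
open Summit.QuantumFields.YangMills.BalabanUVNodes.N15.MatrixSpecies (liftBlk)
open Summit.QuantumFields.YangMills.BalabanUVNodes.N15.OperatorReadout (opGeo)
open Summit.QuantumFields.YangMills.BalabanUVNodes.N15.Gluing (SfIdx sfInstance sfGeo sfqFamily sfqEntry0 ne2PlusOperator_sfq ne2PlusOperator_sfq₄ CvX CvX' cvM cvBlk cvT_one cvGlued cvGlued' cvNL cvNL'
  cvNVq cvNVq')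
open Literature.MathematicalPhysics.QuantumFieldTheory.Balaban1983to89.T4EtaRateDefect (idef)
open Literature.MathematicalPhysics.QuantumFieldTheory.Balaban1983to89.T4EtaRateCoeffDefect (pull)
open Summit.QuantumFields.YangMills.BalabanUVNodes.N15.BackgroundLayer (covLapM gavgM fgrad bgrad)
open Summit.QuantumFields.YangMills.BalabanUVNodes.N15.MatrixSpecies (coordMat liftMap liftEquiv)
open Summit.QuantumFields.YangMills.BalabanUVNodes.N15.CurvedSpecies (gaugePair)
open Summit.QuantumFields.YangMills.BalabanUVNodes.N15.VectorPiece (bshiftEquiv)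
open Summit.QuantumFields.YangMills.BalabanUVNodes.N15.BackgroundLayer (gavgM_zero)
open Summit.QuantumFields.YangMills.BalabanUVNodes.N15.GluedZeroField (zCovC_zero_zero zCovF_zero_zero)
open Literature.MathematicalPhysics.QuantumFieldTheory.Balaban1983to89.B5Prop11Plancherel (Tor)
open Summit.QuantumFields.YangMills.BalabanUVNodes.N15.PairedFamilyGuard (Live)
open Literature.MathematicalPhysics.QuantumFieldTheory.Balaban1983to89.T4Continuum (T4Family ULoop)
open Node00 (NE2Objects₁₁)
open Summit.QuantumFields.YangMills.BalabanUVNodes.N15.AtKeyedHome (s_N15_of_admits)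
open YMDAG.UVSplit (Datum RateCarriers RateRecordPred N15At S_N15 ne2OfRecord₁₁)

variable (d : ℕ) {L : ℕ} [NeZero L] (mm ι : Type) [Fintype mm] [DecidableEq mm] [Fintype ι] [DecidableEq ι] (a : ℝ) (e : Matrix mm mm ℂ ≃L[ℝ] (ι → ℝ))

section AllCov

variable [Nonempty mm]

/-! ## §1 Guard ∧ `N15At` with the operator layer of 189b and the covariantly averaged site ∕ unit layers -/

/-- ★★★ **ALL THREE LAYERS WITH THE COVARIANT AVERAGING** (`d ≥ 1`, odd `L ≥ 7`, `a, c₃₅ > 0`, trace-form-orthonormal `e`, `ι` nonempty): for dag-n15-c's operator-layer entries 1–3 `E`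
with their displayed (3.42)-shaped row `hE`, the literal «operator layer `sfqFamily … (E i)` (189b: entry 0 = the η-defect with Bałaban's covariant summand LIVE), (Q-3)'s site kernel and
(Q-4)'s Dirichlet unit kernel at the CONSTRUCTED covariant averaging `(qDc, qEc, qDf, qEf)`, genuine region `inLamSf`» has the K3⁸ guard and `N15At` at some threshold `w` — (Q-6c) §4's socket
fed with 189b BY NAME. [cite: Balaban1985BackgroundPropagators, Thm 3.1 (3.42) p.397, Thm 3.2 (3.47)–(3.48) p.398 (templates: MODEL level); Balaban1985Averaging, (124)–(125) p.36] -/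
theorem live_and_n15At_sfq_qv_allLiveLam [Nonempty ι] (hd : 1 ≤ d) (hL : Odd L ∧ 1 < L) (hL7 : 7 ≤ L) (ha : 0 < a) {c35 : ℝ} (hc35 : 0 < c35)
    (he : ∀ A B : Matrix mm mm ℂ, traceForm A B = e A ⬝ᵥ e B) (α β : Fin (d + 1)) (j j' : ι) (α' β' : Fin (d + 1)) (j₂ j₂' : ι) (p : ℝ)
    (E : ∀ i : SfIdx d L, Fin 4 → (Fin (d + 1) → CvX' d L i.m i.kk i.r hL → Matrix mm mm ℂ) → ((CvX d L i.m i.kk hL × ι → ℝ) →ₗ[ℝ] (CvX' d L i.m i.kk i.r hL × ι → ℝ)))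
    (hE : ∃ M₁ δ₁ a₁ B₁ γ₁ : ℝ, 0 < M₁ ∧ 0 < δ₁ ∧ 0 < a₁ ∧ 0 < B₁ ∧ 0 < γ₁ ∧
      ∀ i : SfIdx d L, M₁ ≤ (L : ℝ) ^ i.m → ∀ α₀ : ℝ, 0 < α₀ → (L : ℝ) ^ i.m * α₀ ≤ a₁ →
        ∀ A' : Fin (d + 1) → CvX' d L i.m i.kk i.r hL → Matrix mm mm ℂ, (sfInstance d mm ι hL i).Bf.Reg335 c35 α₀ A' → ∀ n : Fin 4, n ≠ 0 →
          HasMaj (BlockNorm.ofBlocks (sfGeo d hL i) (liftBlk (cvBlk d L i.m i.kk hL) ι))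
            (BlockNorm.ofBlocks (sfGeo d hL i) (liftBlk (cvBlk d L i.m i.kk hL ∘ kingPrV L i.kk i.r (cvM d L i.m i.kk hL)) ι)) (E i n A')
            (fun y y' => B₁ * B9.pref4 ((opGeo (sfGeo d hL i) (CvX d L i.m i.kk hL × ι) (liftBlk (cvBlk d L i.m i.kk hL) ι)).len y) n * Real.exp (-(δ₁ * (sfGeo d hL i).dist y y')) *
              max (rateFactor (opGeo (sfGeo d hL i) (CvX d L i.m i.kk hL × ι) (liftBlk (cvBlk d L i.m i.kk hL) ι)) γ₁ y)
                (rateFactor (opGeo (sfGeo d hL i) (CvX d L i.m i.kk hL × ι) (liftBlk (cvBlk d L i.m i.kk hL) ι)) γ₁ y'))) :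
    ∃ w : ℝ,
      Live ⟨SfIdxGE d L w × RegIdx0 d, c35, p, fun x => sfInstance d mm ι hL x.1.1, fun x => sfqFamily d mm ι a e hL x.1.1 (E x.1.1),
          fun x => foSiteCov d mm ι a e hL α β j j' (qDc d mm ι e hL) (qEc d mm ι e hL) (qDf d mm ι e hL) (qEf d mm ι e hL) x.1.1,
          fun x => foCovCovLam d mm ι a e hL α' β' j₂ j₂' (qDc d mm ι e hL) (qEc d mm ι e hL) (qDf d mm ι e hL) (qEf d mm ι e hL) x.1.1 x.2.1, fun x => inLamSf d mm ι hL x.1.1 x.2.1,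
          fun x => (sfInstance d mm ι hL x.1.1).gc.dist⟩ ∧
      N15At { I := SfIdxGE d L w × RegIdx0 d, c35 := c35, p := p, pi := fun x => sfInstance d mm ι hL x.1.1, Kop := fun x => sfqFamily d mm ι a e hL x.1.1 (E x.1.1),
              Ksite := fun x => foSiteCov d mm ι a e hL α β j j' (qDc d mm ι e hL) (qEc d mm ι e hL) (qDf d mm ι e hL) (qEf d mm ι e hL) x.1.1,
              Kunit := fun x => foCovCovLam d mm ι a e hL α' β' j₂ j₂' (qDc d mm ι e hL) (qEc d mm ι e hL) (qDf d mm ι e hL) (qEf d mm ι e hL) x.1.1 x.2.1,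
              inΛ := fun x => inLamSf d mm ι hL x.1.1 x.2.1, unitDist := fun x => (sfInstance d mm ι hL x.1.1).gc.dist } :=
  live_and_n15At_op_qv_allLiveLam d mm ι a e hd hL hL7 ha hc35 he α β j j' α' β' j₂ j₂' p (fun i => sfqFamily d mm ι a e hL i (E i))
    (ne2PlusOperator_sfq d mm ι e hL hL7 ha hc35 he E hE)

end AllCov

/-! ## §2 The honest dictionary at zero background field: the constructed family vanishes, the covariant kernels are the flat ones -/

section ZeroField

open scoped Matrix.Norms.L2Operator

/-- At `A′ = 0` the coarse transporters are the identity: `T_c(0) = 1` (`Ā′ = gavgM π̂ 0 = 0`, `e^{0} = 1`, `cvT e 1 = 1`). [folklore] -/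
theorem qTc_zero (hL : Odd L ∧ 1 < L) (i : SfIdx d L) :
    qTc d mm ι e hL i (0 : Fin (d + 1) → CvX' d L i.m i.kk i.r hL → Matrix mm mm ℂ) = fun _ _ => 1 := by
  unfold qTc
  simp only [gavgM_zero, Pi.zero_apply, smul_zero, NormedSpace.exp_zero]
  exact cvT_one e

omit [NeZero L] in
/-- At `A′ = 0` the fine transporters are the identity: `T_f(0) = 1`. [folklore] -/
theorem qTf_zero (hL : Odd L ∧ 1 < L) (i : SfIdx d L) :
    qTf d mm ι e hL i (0 : Fin (d + 1) → CvX' d L i.m i.kk i.r hL → Matrix mm mm ℂ) = fun _ _ => 1 := by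
  unfold qTf
  simp only [Pi.zero_apply, smul_zero, NormedSpace.exp_zero]
  exact cvT_one e

/-- ★ `D_c(0) = 0`: at zero background field the covariant block averaging IS the flat one (`Q(1) = Q ⊗ 1_ι`). [cite: Balaban1985BackgroundPropagators, (3.80) p.406 (`F₂(0) = 0`: shape)] -/
theorem qDc_zero (hL : Odd L ∧ 1 < L) (i : SfIdx d L) : qDc d mm ι e hL i (0 : Fin (d + 1) → CvX' d L i.m i.kk i.r hL → Matrix mm mm ℂ) = 0 := by
  rw [qDc_eq, qTc_zero, sub_self]

/-- `E_c(0) = 0`. [cite: Balaban1985BackgroundPropagators, (3.80) p.406 (shape)] -/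
theorem qEc_zero (hL : Odd L ∧ 1 < L) (i : SfIdx d L) : qEc d mm ι e hL i (0 : Fin (d + 1) → CvX' d L i.m i.kk i.r hL → Matrix mm mm ℂ) = 0 := by
  rw [qEc_eq, qTc_zero, sub_self]

/-- `D_f(0) = 0`. [cite: Balaban1985BackgroundPropagators, (3.80) p.406 (shape)] -/
theorem qDf_zero (hL : Odd L ∧ 1 < L) (i : SfIdx d L) : qDf d mm ι e hL i (0 : Fin (d + 1) → CvX' d L i.m i.kk i.r hL → Matrix mm mm ℂ) = 0 := by
  rw [qDf_eq, qTf_zero, sub_self]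

/-- `E_f(0) = 0`. [cite: Balaban1985BackgroundPropagators, (3.80) p.406 (shape)] -/
theorem qEf_zero (hL : Odd L ∧ 1 < L) (i : SfIdx d L) : qEf d mm ι e hL i (0 : Fin (d + 1) → CvX' d L i.m i.kk i.r hL → Matrix mm mm ℂ) = 0 := by
  rw [qEf_eq, qTf_zero, sub_self]

/-- ★ **CONSISTENCY OF THE SITE LAYER AT ZERO FIELD**: at `A′ = 0` the covariantly averaged site kernel IS (J-c)'s flatly averaged `foSiteSf` (every index and sites). [bookkeeping] -/
theorem foSiteCov_qv_ker_zero (hL : Odd L ∧ 1 < L) (α β : Fin (d + 1)) (j j' : ι) (i : SfIdx d L) (y y' : Tor (cvM d L i.m i.kk hL)) :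
    (foSiteCov d mm ι a e hL α β j j' (qDc d mm ι e hL) (qEc d mm ι e hL) (qDf d mm ι e hL) (qEf d mm ι e hL) i).ker (0 : Fin (d + 1) → CvX' d L i.m i.kk i.r hL → Matrix mm mm ℂ) y y' =
      (foSiteSf d mm ι a e hL α β j j' i).ker (0 : Fin (d + 1) → CvX' d L i.m i.kk i.r hL → Matrix mm mm ℂ) y y' := by
  rw [foSiteCov_ker, foSiteSf_ker, qDc_zero, qEc_zero, qDf_zero, qEf_zero, zCovC_zero_zero, zCovF_zero_zero]

/-- ★ **CONSISTENCY OF THE UNIT LAYER AT ZERO FIELD**: at `A′ = 0` the covariantly averaged Dirichlet unit kernel IS (Ð-4)'s flatly averaged `foCovSfLam` (every index, region and sites). [bookkeeping] -/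
theorem foCovCovLam_qv_ker_zero (hL : Odd L ∧ 1 < L) (α β : Fin (d + 1)) (j j' : ι) (i : SfIdx d L) (Λ'₀ : Finset (Fin (d + 1) → ℤ)) (y y' : Tor (cvM d L i.m i.kk hL)) :
    (foCovCovLam d mm ι a e hL α β j j' (qDc d mm ι e hL) (qEc d mm ι e hL) (qDf d mm ι e hL) (qEf d mm ι e hL) i Λ'₀).ker (0 : Fin (d + 1) → CvX' d L i.m i.kk i.r hL → Matrix mm mm ℂ) y y' =
      (foCovSfLam d mm ι a e hL α β j j' i Λ'₀).ker (0 : Fin (d + 1) → CvX' d L i.m i.kk i.r hL → Matrix mm mm ℂ) y y' := by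
  rw [foCovCovLam_ker, foCovSfLam_ker, qDc_zero, qEc_zero, qDf_zero, qEf_zero, zCovC_zero_zero, zCovF_zero_zero]

end ZeroField

/-! ## §3 Σ-Q: 193b's entry assignment made concrete — the CLOSED all-covariant literal (no parameter, no displayed row) -/

section Closed

open scoped Matrix.Norms.L2Operator

variable [Nonempty mm]

/-- **THE ENTRY ASSIGNMENT OF n15-c 193b MADE CONCRETE** (`Σ-Q`, the twin of Σ-F's `sfE₄cov` for the (P-Q) family): slot 0 = n15-c's `sfqEntry0` (the η-defect of the glued propagators with
the covariant Bałaban summand `N_L⊗1 − N_V^Q` live — `sfqFamily` fixes entry 0 itself, the slot is bookkeeping), slots 1–2 = 193b's covariant-gradient η-defects in the directions `ν₁, ν₂`,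
slot 3 = 193b's Laplacian η-defect — the three displayed right-hand sides `hE1`∕`hE2`∕`hE3` of `Gluing.ne2PlusOperator_sfq₄`, letter for letter.
[cite: Balaban1985BackgroundPropagators, Thm 3.1 (3.42) p.397 (the four entries: shape), (3.50)–(3.52) p.400] -/
def sfqE₄ (hL : Odd L ∧ 1 < L) (ν₁ ν₂ : Fin (d + 1) ⊕ Fin (d + 1)) (i : SfIdx d L) :
    Fin 4 → (Fin (d + 1) → CvX' d L i.m i.kk i.r hL → Matrix mm mm ℂ) → ((CvX d L i.m i.kk hL × ι → ℝ) →ₗ[ℝ] (CvX' d L i.m i.kk i.r hL × ι → ℝ)) :=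
  fun n A' => ![sfqEntry0 d mm ι a e hL i A',
      idef (pull (liftMap (kingPrV L i.kk i.r (cvM d L i.m i.kk hL)) ι)) (pull (liftMap (kingPrV L i.kk i.r (cvM d L i.m i.kk hL)) ι))
      (Sum.elim (fun μ => fgrad (((((L ^ i.r * L ^ i.kk : ℕ) : ℝ))⁻¹))⁻¹ (liftEquiv (bshiftEquiv (cvM d L i.m i.kk hL) (L ^ i.r * L ^ i.kk) μ) ι)) (fun μ => bgrad (((((L ^ i.r * L ^ i.kk : ℕ) : ℝ))⁻¹))⁻¹ (liftEquiv (bshiftEquiv (cvM d L i.m i.kk hL) (L ^ i.r * L ^ i.kk) μ) ι)) ν₁ ∘ₗ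
      cvGlued' d L i.m i.kk i.r hL a ((((L ^ i.r * L ^ i.kk : ℕ) : ℝ))⁻¹) ι e (fun _ _ => (1 : Matrix mm mm ℂ)) (fun μ x' => NormedSpace.exp (((((L ^ i.r * L ^ i.kk : ℕ) : ℝ))⁻¹) • A' μ x')) (cvNL' d L i.m i.kk i.r hL a ι - (cvNVq' d L i.m i.kk i.r hL a ι e (fun μ x' => NormedSpace.exp (((((L ^ i.r * L ^ i.kk : ℕ) : ℝ))⁻¹) • A' μ x')))) (fun _ => (cvNVq' d L i.m i.kk i.r hL a ι e (fun μ x' => NormedSpace.exp (((((L ^ i.r * L ^ i.kk : ℕ) : ℝ))⁻¹) • A' μ x')))))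
      (Sum.elim (fun μ => fgrad (((((L ^ i.kk : ℕ) : ℝ))⁻¹))⁻¹ (liftEquiv (bshiftEquiv (cvM d L i.m i.kk hL) (L ^ i.kk) μ) ι)) (fun μ => bgrad (((((L ^ i.kk : ℕ) : ℝ))⁻¹))⁻¹ (liftEquiv (bshiftEquiv (cvM d L i.m i.kk hL) (L ^ i.kk) μ) ι)) ν₁ ∘ₗ
      cvGlued d L i.m i.kk hL a ((((L ^ i.kk : ℕ) : ℝ))⁻¹) ι e (fun _ _ => (1 : Matrix mm mm ℂ)) (fun μ x => NormedSpace.exp (((((L ^ i.kk : ℕ) : ℝ))⁻¹) • gavgM (Matrix mm mm ℂ) (Fin (d + 1)) (kingPrV L i.kk i.r (cvM d L i.m i.kk hL)) A' μ x)) (cvNL d L i.m i.kk hL a ι - (cvNVq d L i.m i.kk hL a ι e (fun μ x => NormedSpace.exp (((((L ^ i.kk : ℕ) : ℝ))⁻¹) • gavgM (Matrix mm mm ℂ) (Fin (d + 1)) (kingPrV L i.kk i.r (cvM d L i.m i.kk hL)) A' μ x)))) (fun _ => (cvNVq d L i.m i.kk hL a ι e (fun μ x => NormedSpace.exp (((((L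 ^ i.kk : ℕ) : ℝ))⁻¹) • gavgM (Matrix mm mm ℂ) (Fin (d + 1)) (kingPrV L i.kk i.r (cvM d L i.m i.kk hL)) A' μ x))))),
      idef (pull (liftMap (kingPrV L i.kk i.r (cvM d L i.m i.kk hL)) ι)) (pull (liftMap (kingPrV L i.kk i.r (cvM d L i.m i.kk hL)) ι))
      (Sum.elim (fun μ => fgrad (((((L ^ i.r * L ^ i.kk : ℕ) : ℝ))⁻¹))⁻¹ (liftEquiv (bshiftEquiv (cvM d L i.m i.kk hL) (L ^ i.r * L ^ i.kk) μ) ι)) (fun μ => bgrad (((((L ^ i.r * L ^ i.kk : ℕ) : ℝ))⁻¹))⁻¹ (liftEquiv (bshiftEquiv (cvM d L i.m i.kk hL) (L ^ i.r * L ^ i.kk) μ) ι)) ν₂ ∘ₗ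
      cvGlued' d L i.m i.kk i.r hL a ((((L ^ i.r * L ^ i.kk : ℕ) : ℝ))⁻¹) ι e (fun _ _ => (1 : Matrix mm mm ℂ)) (fun μ x' => NormedSpace.exp (((((L ^ i.r * L ^ i.kk : ℕ) : ℝ))⁻¹) • A' μ x')) (cvNL' d L i.m i.kk i.r hL a ι - (cvNVq' d L i.m i.kk i.r hL a ι e (fun μ x' => NormedSpace.exp (((((L ^ i.r * L ^ i.kk : ℕ) : ℝ))⁻¹) • A' μ x')))) (fun _ => (cvNVq' d L i.m i.kk i.r hL a ι e (fun μ x' => NormedSpace.exp (((((L ^ i.r * L ^ i.kk : ℕ) : ℝ))⁻¹) • A' μ x')))))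
      (Sum.elim (fun μ => fgrad (((((L ^ i.kk : ℕ) : ℝ))⁻¹))⁻¹ (liftEquiv (bshiftEquiv (cvM d L i.m i.kk hL) (L ^ i.kk) μ) ι)) (fun μ => bgrad (((((L ^ i.kk : ℕ) : ℝ))⁻¹))⁻¹ (liftEquiv (bshiftEquiv (cvM d L i.m i.kk hL) (L ^ i.kk) μ) ι)) ν₂ ∘ₗ
      cvGlued d L i.m i.kk hL a ((((L ^ i.kk : ℕ) : ℝ))⁻¹) ι e (fun _ _ => (1 : Matrix mm mm ℂ)) (fun μ x => NormedSpace.exp (((((L ^ i.kk : ℕ) : ℝ))⁻¹) • gavgM (Matrix mm mm ℂ) (Fin (d + 1)) (kingPrV L i.kk i.r (cvM d L i.m i.kk hL)) A' μ x)) (cvNL d L i.m i.kk hL a ι - (cvNVq d L i.m i.kk hL a ι e (fun μ x => NormedSpace.exp (((((L ^ i.kk : ℕ) : ℝ))⁻¹) • gavgM (Matrix mm mm ℂ) (Fin (d + 1)) (kingPrV L i.kk i.r (cvM d L i.m i.kk hL)) A' μ x)))) (fun _ => (cvNVq d L i.m i.kk hL a ι e (fun μ x => NormedSpace.exp (((((L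 ^ i.kk : ℕ) : ℝ))⁻¹) • gavgM (Matrix mm mm ℂ) (Fin (d + 1)) (kingPrV L i.kk i.r (cvM d L i.m i.kk hL)) A' μ x))))),
      idef (pull (liftMap (kingPrV L i.kk i.r (cvM d L i.m i.kk hL)) ι)) (pull (liftMap (kingPrV L i.kk i.r (cvM d L i.m i.kk hL)) ι)) ((covLapM (bshiftEquiv (cvM d L i.m i.kk hL) (L ^ i.r * L ^ i.kk)) ((((L ^ i.r * L ^ i.kk : ℕ) : ℝ))⁻¹) (gaugePair (bshiftEquiv (cvM d L i.m i.kk hL) (L ^ i.r * L ^ i.kk)) (fun μ x' => coordMat e (ContinuousLinearMap.mulLeftRight ℝ (Matrix mm mm ℂ) (NormedSpace.exp (((((L ^ i.r * L ^ i.kk : ℕ) : ℝ))⁻¹) • A' μ x')) (NormedSpace.exp (((((L ^ i.r * L ^ i.kk : ℕ) : ℝ))⁻¹) • A' μ x'))ᴴ)))) ∘ₗ (cvGlued' d L i.m i.kk i.r hL a ((((L ^ i.r * L ^ i.kk : ℕ) : ℝ))⁻¹) ι e (fun _ _ => (1 : Matrix mm mm ℂ)) (fun μ x' => NormedSpace.exp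 (((((L ^ i.r * L ^ i.kk : ℕ) : ℝ))⁻¹) • A' μ x')) (cvNL' d L i.m i.kk i.r hL a ι - (cvNVq' d L i.m i.kk i.r hL a ι e (fun μ x' => NormedSpace.exp (((((L ^ i.r * L ^ i.kk : ℕ) : ℝ))⁻¹) • A' μ x')))) (fun _ => (cvNVq' d L i.m i.kk i.r hL a ι e (fun μ x' => NormedSpace.exp (((((L ^ i.r * L ^ i.kk : ℕ) : ℝ))⁻¹) • A' μ x')))))) ((covLapM (bshiftEquiv (cvM d L i.m i.kk hL) (L ^ i.kk)) ((((L ^ i.kk : ℕ) : ℝ))⁻¹) (gaugePair (bshiftEquiv (cvM d L i.m i.kk hL) (L ^ i.kk)) (fun μ x => coordMat e (ContinuousLinearMap.mulLeftRight ℝ (Matrix mm mm ℂ) (NormedSpace.exp (((((L ^ i.kk : ℕ) : ℝ))⁻¹) • gavgM (Matrix mm mm ℂ) (Fin (d + 1)) (kingPrV L i.kk i.r (cvM d L i.m i.kk hL)) A' μ x)) (NormedSpace.exp (((((L ^ i.kk : ℕ) : ℝ))⁻¹) • gavgM (Matrix mm mm ℂ) (Fin (d + 1)) (kingPrV L i.kk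 i.r (cvM d L i.m i.kk hL)) A' μ x))ᴴ)))) ∘ₗ (cvGlued d L i.m i.kk hL a ((((L ^ i.kk : ℕ) : ℝ))⁻¹) ι e (fun _ _ => (1 : Matrix mm mm ℂ)) (fun μ x => NormedSpace.exp (((((L ^ i.kk : ℕ) : ℝ))⁻¹) • gavgM (Matrix mm mm ℂ) (Fin (d + 1)) (kingPrV L i.kk i.r (cvM d L i.m i.kk hL)) A' μ x)) (cvNL d L i.m i.kk hL a ι - (cvNVq d L i.m i.kk hL a ι e (fun μ x => NormedSpace.exp (((((L ^ i.kk : ℕ) : ℝ))⁻¹) • gavgM (Matrix mm mm ℂ) (Fin (d + 1)) (kingPrV L i.kk i.r (cvM d L i.m i.kk hL)) A' μ x)))) (fun _ => (cvNVq d L i.m i.kk hL a ι e (fun μ x => NormedSpace.exp (((((L ^ i.kk : ℕ) : ℝ))⁻¹) • gavgM (Matrix mm mm ℂ) (Fin (d + 1)) (kingPrV L i.kk i.r (cvM d L i.m i.kk hL)) A' μ x))))))] n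

set_option maxRecDepth 8192 in
/-- ★★★ **`NE2PlusOperator` FOR THE (P-Q) FAMILY WITH ALL FOUR ENTRIES CONCRETE** — n15-c 193b `ne2PlusOperator_sfq₄` fed with `Σ-Q = sfqE₄ … ν₁ ν₂` (`rfl` ×3): the operator layer with the
covariant averaging summand LIVE in entry 0 and NO parameter ∕ NO displayed row (odd `L ≥ 7`, `a, c₃₅ > 0`, trace-form-orthonormal `e`). MODEL family ([5] (125) main term; Landau summand flat);
NOT [B9] Thm 3.1∕3.14 as printed. [cite: Balaban1985BackgroundPropagators, Thm 3.1 (3.42) p.397 (template: MODEL level); Balaban1985Averaging, (124)–(125) p.36] -/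
theorem ne2PlusOperator_sfq₄E (hL : Odd L ∧ 1 < L) (hL7 : 7 ≤ L) (ha : 0 < a) {c35 : ℝ} (hc35 : 0 < c35) (he : ∀ A B : Matrix mm mm ℂ, traceForm A B = e A ⬝ᵥ e B)
    (ν₁ ν₂ : Fin (d + 1) ⊕ Fin (d + 1)) :
    NE2PlusOperator c35 (sfInstance d mm ι hL) (fun i => sfqFamily d mm ι a e hL i (sfqE₄ d mm ι a e hL ν₁ ν₂ i)) :=
  ne2PlusOperator_sfq₄ d mm ι e hL hL7 ha hc35 he ν₁ ν₂ (sfqE₄ d mm ι a e hL ν₁ ν₂) (fun _ _ => rfl) (fun _ _ => rfl) (fun _ _ => rfl)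

/-- **THE CLOSED ALL-COVARIANT ROAD-(c) LITERAL** at a size threshold `w`: operator layer `sfqFamily … (Σ-Q)`, (Q-3)'s site kernel and (Q-4)'s Dirichlet unit kernel at the CONSTRUCTED covariant
averaging `(qDc, qEc, qDf, qEf)`, genuine region `inLamSf`, on `SfIdxGE d L w × RegIdx0 d` — NO parameter family, NO displayed row. [bookkeeping] -/
def sfObjects₅qv (hL : Odd L ∧ 1 < L) (ν₁ ν₂ : Fin (d + 1) ⊕ Fin (d + 1)) (α β : Fin (d + 1)) (j j' : ι) (α' β' : Fin (d + 1)) (j₂ j₂' : ι) (c35 p w : ℝ) : NE2Objects₁₁ :=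
  ⟨SfIdxGE d L w × RegIdx0 d, c35, p, fun x => sfInstance d mm ι hL x.1.1, fun x => sfqFamily d mm ι a e hL x.1.1 (sfqE₄ d mm ι a e hL ν₁ ν₂ x.1.1),
    fun x => foSiteCov d mm ι a e hL α β j j' (qDc d mm ι e hL) (qEc d mm ι e hL) (qDf d mm ι e hL) (qEf d mm ι e hL) x.1.1,
    fun x => foCovCovLam d mm ι a e hL α' β' j₂ j₂' (qDc d mm ι e hL) (qEc d mm ι e hL) (qDf d mm ι e hL) (qEf d mm ι e hL) x.1.1 x.2.1, fun x => inLamSf d mm ι hL x.1.1 x.2.1,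
    fun x => (sfInstance d mm ι hL x.1.1).gc.dist⟩

/-- ★★★ **GUARD ∧ `N15At` AT THE CLOSED ALL-COVARIANT LITERAL, SOME THRESHOLD** (`d ≥ 1`, odd `L ≥ 7`, `a, c₃₅ > 0`, trace-form-orthonormal `e`, `ι` nonempty): (Q-6c) §4's socket fed with
`ne2PlusOperator_sfq₄E` — ALL THREE LAYERS carry dag-n15-c's covariant averaging and NOTHING is displayed or parametric any more.
[cite: Balaban1985BackgroundPropagators, Thm 3.1 (3.42) p.397, Thm 3.2 (3.47)–(3.48) p.398 (templates: MODEL level); Balaban1985Averaging, (124)–(125) p.36] -/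
theorem exists_live_and_n15At_sfObjects₅qv [Nonempty ι] (hd : 1 ≤ d) (hL : Odd L ∧ 1 < L) (hL7 : 7 ≤ L) (ha : 0 < a) {c35 : ℝ} (hc35 : 0 < c35)
    (he : ∀ A B : Matrix mm mm ℂ, traceForm A B = e A ⬝ᵥ e B) (ν₁ ν₂ : Fin (d + 1) ⊕ Fin (d + 1)) (α β : Fin (d + 1)) (j j' : ι) (α' β' : Fin (d + 1)) (j₂ j₂' : ι) (p : ℝ) :
    ∃ w : ℝ, Live (ne2OfRecord₁₁ (sfObjects₅qv d mm ι a e hL ν₁ ν₂ α β j j' α' β' j₂ j₂' c35 p w)) ∧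
      N15At (ne2OfRecord₁₁ (sfObjects₅qv d mm ι a e hL ν₁ ν₂ α β j j' α' β' j₂ j₂' c35 p w)) :=
  live_and_n15At_op_qv_allLiveLam d mm ι a e hd hL hL7 ha hc35 he α β j j' α' β' j₂ j₂' p _ (ne2PlusOperator_sfq₄E d mm ι a e hL hL7 ha hc35 he ν₁ ν₂)

/-- **THE PINNED THRESHOLD** `w_Q5` of the closed all-covariant literal (a `Classical.choose`). [bookkeeping] -/
def wQ5 [Nonempty ι] (hd : 1 ≤ d) (hL : Odd L ∧ 1 < L) (hL7 : 7 ≤ L) (ha : 0 < a) {c35 : ℝ} (hc35 : 0 < c35) (he : ∀ A B : Matrix mm mm ℂ, traceForm A B = e A ⬝ᵥ e B)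
    (ν₁ ν₂ : Fin (d + 1) ⊕ Fin (d + 1)) (α β : Fin (d + 1)) (j j' : ι) (α' β' : Fin (d + 1)) (j₂ j₂' : ι) (p : ℝ) : ℝ :=
  Classical.choose (exists_live_and_n15At_sfObjects₅qv d mm ι a e hd hL hL7 ha hc35 he ν₁ ν₂ α β j j' α' β' j₂ j₂' p)

/-- ★★★ **GUARD ∧ `N15At` AT THE CLOSED ALL-COVARIANT LITERAL PINNED AT `w_Q5`** — the lane's most print-faithful `Live ∧ N15At`: printed-shape operator layer with the covariant averaging summand
live (n15-c 188∕189b∕193b), covariantly averaged site and unit sandwiches ((Q-6)), genuine Dirichlet region; MODEL carriers. [cite: Balaban1985BackgroundPropagators, (3.42) p.397, Thms 3.1∕3.2 p.398 (shape)] -/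
theorem live_and_n15At_sfObjects₅qv_wQ5 [Nonempty ι] (hd : 1 ≤ d) (hL : Odd L ∧ 1 < L) (hL7 : 7 ≤ L) (ha : 0 < a) {c35 : ℝ} (hc35 : 0 < c35)
    (he : ∀ A B : Matrix mm mm ℂ, traceForm A B = e A ⬝ᵥ e B) (ν₁ ν₂ : Fin (d + 1) ⊕ Fin (d + 1)) (α β : Fin (d + 1)) (j j' : ι) (α' β' : Fin (d + 1)) (j₂ j₂' : ι) (p : ℝ) :
    Live (ne2OfRecord₁₁ (sfObjects₅qv d mm ι a e hL ν₁ ν₂ α β j j' α' β' j₂ j₂' c35 p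
        (wQ5 d mm ι a e hd hL hL7 ha hc35 he ν₁ ν₂ α β j j' α' β' j₂ j₂' p))) ∧
      N15At (ne2OfRecord₁₁ (sfObjects₅qv d mm ι a e hL ν₁ ν₂ α β j j' α' β' j₂ j₂' c35 p
        (wQ5 d mm ι a e hd hL hL7 ha hc35 he ν₁ ν₂ α β j j' α' β' j₂ j₂' p))) :=
  Classical.choose_spec (exists_live_and_n15At_sfObjects₅qv d mm ι a e hd hL hL7 ha hc35 he ν₁ ν₂ α β j j' α' β' j₂ j₂' p)

variable {N : ℕ} [NeZero N] {key : (F : T4Family) → Datum F N → Prop}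

/-- ★★ **THE CLOSED ALL-COVARIANT LITERAL AT ANY KEYED HOME** (part 30's interface): a rate home over ANY key admitting only the literals of a key-indexed NE2 reading whose value everywhere is
the pinned closed all-covariant literal has `S_N15 RRec`. [bookkeeping] -/
theorem s_N15_of_admits_sf₅qv [Nonempty ι] (hd : 1 ≤ d) (hL : Odd L ∧ 1 < L) (hL7 : 7 ≤ L) (ha : 0 < a) {c35 : ℝ} (hc35 : 0 < c35)
    (he : ∀ A B : Matrix mm mm ℂ, traceForm A B = e A ⬝ᵥ e B) (ν₁ ν₂ : Fin (d + 1) ⊕ Fin (d + 1)) (α β : Fin (d + 1)) (j j' : ι) (α' β' : Fin (d + 1)) (j₂ j₂' : ι) (p : ℝ)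
    (ne2At : ∀ {F : T4Family} {D : Datum F N}, key F D → (ℕ → ℝ) → List (ULoop F) → ℕ → NE2Objects₁₁) (RRec : RateRecordPred N)
    (hadm : ∀ (F : T4Family) (D : Datum F N) (g₀ : ℕ → ℝ) (os : List (ULoop F)) (R : RateCarriers N), RRec F D g₀ os R →
      ∃ (h : key F D) (k : ℕ), R.ne2 = ne2OfRecord₁₁ (ne2At h g₀ os k))
    (h : ∀ (F : T4Family) (D : Datum F N) (h : key F D) (g₀ : ℕ → ℝ) (os : List (ULoop F)) (k : ℕ),
      ne2At h g₀ os k = sfObjects₅qv d mm ι a e hL ν₁ ν₂ α β j j' α' β' j₂ j₂' c35 p (wQ5 d mm ι a e hd hL hL7 ha hc35 he ν₁ ν₂ α β j j' α' β' j₂ j₂' p)) :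
    S_N15 RRec :=
  s_N15_of_admits ne2At RRec hadm fun F D hk g₀ os k => by
    rw [h F D hk g₀ os k]
    exact (live_and_n15At_sfObjects₅qv_wQ5 d mm ι a e hd hL hL7 ha hc35 he ν₁ ν₂ α β j j' α' β' j₂ j₂' p).2

end Closed

/-! ## §4 The closed all-covariant literal in the trace-form coordinates `tfCoords` — no hypothesis left but numbers -/

section Unconditional

variable [Nonempty mm]

/-- ★★★ **GUARD ∧ `N15At` AT THE CLOSED ALL-COVARIANT LITERAL, TRACE-FORM COORDINATES SUPPLIED** (`e := tfCoords mm`, `ι := Fin 2 × mm × mm`; (T-1) `traceForm_eq_tfCoords_dotProduct`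
discharges `he`): the remaining hypotheses are PURELY NUMERIC — `1 ≤ d`, odd `L ≥ 7`, `0 < a`, `0 < c₃₅`, `mm` nonempty. MODEL carriers; NOT [B9] Thms 3.1∕3.2 AS PRINTED.
[cite: Balaban1985BackgroundPropagators, (3.42) p.397, Thms 3.1∕3.2 p.398 (shape)] -/
theorem live_and_n15At_sfObjects₅qv_tf (hd : 1 ≤ d) (hL : Odd L ∧ 1 < L) (hL7 : 7 ≤ L) (ha : 0 < a) {c35 : ℝ} (hc35 : 0 < c35)
    (ν₁ ν₂ : Fin (d + 1) ⊕ Fin (d + 1)) (α β : Fin (d + 1)) (j j' : Fin 2 × mm × mm) (α' β' : Fin (d + 1)) (j₂ j₂' : Fin 2 × mm × mm) (p : ℝ) :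
    Live (ne2OfRecord₁₁ (sfObjects₅qv d mm (Fin 2 × mm × mm) a (TraceFormCoords.tfCoords mm) hL ν₁ ν₂ α β j j' α' β' j₂ j₂' c35 p
        (wQ5 d mm (Fin 2 × mm × mm) a (TraceFormCoords.tfCoords mm) hd hL hL7 ha hc35 (TraceFormCoords.traceForm_eq_tfCoords_dotProduct mm) ν₁ ν₂ α β j j' α' β' j₂ j₂' p))) ∧
      N15At (ne2OfRecord₁₁ (sfObjects₅qv d mm (Fin 2 × mm × mm) a (TraceFormCoords.tfCoords mm) hL ν₁ ν₂ α β j j' α' β' j₂ j₂' c35 p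
        (wQ5 d mm (Fin 2 × mm × mm) a (TraceFormCoords.tfCoords mm) hd hL hL7 ha hc35 (TraceFormCoords.traceForm_eq_tfCoords_dotProduct mm) ν₁ ν₂ α β j j' α' β' j₂ j₂' p))) :=
  live_and_n15At_sfObjects₅qv_wQ5 d mm (Fin 2 × mm × mm) a (TraceFormCoords.tfCoords mm) hd hL hL7 ha hc35 (TraceFormCoords.traceForm_eq_tfCoords_dotProduct mm)
    ν₁ ν₂ α β j j' α' β' j₂ j₂' p

include mm in
/-- ★★ **EXISTENCE FORM**: for every `d ≥ 1`, odd `L ≥ 7`, `a, c₃₅ > 0` and nonempty colour type `mm` there IS an NE2 literal of the closed all-covariant kind with the K3⁸ guard and `N15At` —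
no standing hypothesis of the road-(c) chain is left open (`he` witnessed by (T-1), `ι` nonempty, threshold pinned). [bookkeeping] -/
theorem exists_closed_allCovariant_literal (hd : 1 ≤ d) (hL : Odd L ∧ 1 < L) (hL7 : 7 ≤ L) (ha : 0 < a) {c35 : ℝ} (hc35 : 0 < c35) (p : ℝ) :
    ∃ O : NE2Objects₁₁, O.c35 = c35 ∧ O.p = p ∧ Live (ne2OfRecord₁₁ O) ∧ N15At (ne2OfRecord₁₁ O) := by
  classical
  obtain ⟨m₀⟩ := ‹Nonempty mm›
  exact ⟨_, rfl, rfl, live_and_n15At_sfObjects₅qv_tf d mm a hd hL hL7 ha hc35 (Sum.inl 0) (Sum.inl 0) 0 0 (0, m₀, m₀) (0, m₀, m₀) 0 0 (0, m₀, m₀) (0, m₀, m₀) p⟩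

end Unconditional

end Summit.QuantumFields.YangMills.BalabanUVNodes.N15.SiteLayerSf

end
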